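import Literature.Computability.AlgebraicComplexity.ConstantFreeDegree
import Literature.Computability.AlgebraicComplexity.HamiltonianCycleVNP
import HarnessLib

/-!
# The Hamiltonian cycle family is in `VNP⁰` (constant-free Valiant class)

`HC = (HC_n)_n ∈ VNP⁰` — the constant-free reading (Malod 2003; Bürgisser 2009, Def. 2.8) of
Valiant's `HC ∈ VNP` (Bürgisser–Clausen–Shokrollahi 1997, Prop. (21.15) "PER and HC belong to
VNP"), recorded as such in Tavenas's thesis (2014, §1.3, p. 18, held text
`paper:doi-10-70675-52eccebdz020az4a8dz8517z14d4aa632482 p0023.txt:L45`: "En particulier :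
`Det_n ∈ VP0` et `Perm_n, Ham_n ∈ VNP0`"). Sibling of `PermanentVNP0.lean` (`PER ∈ VNP⁰`) and of
`SkewCircuitFormalDegree.lean` (`(det_n) ∈ VP⁰`); cell `val-lit`, seat t15.

The tree's witness for `HC ∈ VNP` (`HamiltonianCycleVNP.lean`, `hcVNPWitness m k` for `HC_{m+2}`:
BCS's permutation-matrix recogniser `α β` on a position matrix, times `Z_{(0,0)}` and the cover
product, `boolSum_hcVNPWitness`) uses only the constants `±1`, so the `(size, formal degree)`
calculus `HasTauDeg` of `ConstantFreeDegree.lean` shows that the witness family is in `VP⁰`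
(size `≤ 9 (m+2)^4`, formal degree `≤ 3 (m+2)^4`; `2n²` variables), whence `HC ∈ VNP⁰`
(`isVNP0Family_hcPoly`). Theorem-only file; no named facts. HONEST FRAMING: a class membership
of a standard family; VP ≠ VNP is NOT proved and nothing here is progress on it.

## References
* [Tavenas2014] S. Tavenas, thèse ENS Lyon 2014, §1.3 "Classes sans constantes", p. 18.
* [Burgisser2006] P. Bürgisser, ECCC TR06-113 = Comput. Complexity 18 (2009), Def. 2.7–2.8.
* [BurgisserClausenShokrollahi1997] Prop. (21.15) (the witness).
-/

noncomputable section

open MvPolynomial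

universe u v w

namespace Literature.Computability.AlgebraicComplexity

/-! ### Size and formal degree of the witness -/

/-- BCS's `α` (product over the `≤ n⁴` conflicting pairs of `1 - Z_p Z_q`): size `≤ 4 n^4`,
formal degree `≤ 2 n^4 + 1` (`n = m + 2`). [cite: BurgisserClausenShokrollahi1997, Prop. (21.15)] -/
theorem hasTauDeg_hcVNPAlpha (m : ℕ) :
    HasTauDeg (hcVNPAlpha m ℤ) (4 * (m + 2) ^ 4) (2 * (m + 2) ^ 4 + 1) := by
  unfold hcVNPAlpha
  have hterm : ∀ pq ∈ conflictPairs (m + 2),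
      HasTauDeg ((1 - X (Sum.inr (finProdFinEquiv pq.1)) * X (Sum.inr (finProdFinEquiv pq.2)) :
        MvPolynomial (HCVars m) ℤ)) 3 2 := by
    intro pq _
    have h := ((HasTauDeg.X (σ := HCVars m) (Sum.inr (finProdFinEquiv pq.1))).mul
      (HasTauDeg.X (Sum.inr (finProdFinEquiv pq.2)))).one_sub
    exact h.mono (by omega) (by simp)
  have hcard := card_conflictPairs_le (m + 2)
  refine (HasTauDeg.finset_prod _ hterm).mono ?_ ?_
  · simp only [Finset.sum_const, smul_eq_mul]
    nlinarith
  · nlinarith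

/-- BCS's `β = ∏_t ∑_i Z_{(t,i)}`: size `≤ n² + n`, formal degree `≤ n + 1`.
[cite: BurgisserClausenShokrollahi1997, Prop. (21.15)] -/
theorem hasTauDeg_hcVNPBeta (m : ℕ) :
    HasTauDeg (hcVNPBeta m ℤ) ((m + 2) * (m + 2) + (m + 2)) ((m + 2) + 1) := by
  unfold hcVNPBeta
  have hrow : ∀ t ∈ (Finset.univ : Finset (Fin (m + 2))),
      HasTauDeg (∑ i : Fin (m + 2), (X (Sum.inr (finProdFinEquiv (t, i))) :
        MvPolynomial (HCVars m) ℤ)) (m + 2) 1 := by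
    intro t _
    refine (HasTauDeg.finset_sum _ fun i _ =>
      HasTauDeg.X (σ := HCVars m) (Sum.inr (finProdFinEquiv (t, i)))).mono ?_ ?_
    · simp
    · simp
  refine (HasTauDeg.finset_prod _ hrow).mono ?_ ?_
  · simp
  · simp

/-- The cover product `∏_t ∑_{i,j} Z_{(t,i)} Z_{(t+1,j)} X_{(j,i)}`: size `≤ 3n³ + n² + n`, formal
degree `≤ 3n + 1`. [cite: BurgisserClausenShokrollahi1997, Prop. (21.15)] -/
theorem hasTauDeg_hcVNPCover (m : ℕ) :
    HasTauDeg (hcVNPCover m ℤ)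
      ((m + 2) * (3 * (m + 2) * (m + 2) + (m + 2)) + (m + 2)) ((m + 2) * 3 + 1) := by
  unfold hcVNPCover
  have hterm : ∀ (t i j : Fin (m + 2)),
      HasTauDeg ((X (Sum.inr (finProdFinEquiv (t, i))) *
          X (Sum.inr (finProdFinEquiv (finRotate (m + 2) t, j))) * X (Sum.inl (j, i)) :
        MvPolynomial (HCVars m) ℤ)) 2 3 := by
    intro t i j
    have h := ((HasTauDeg.X (σ := HCVars m) (Sum.inr (finProdFinEquiv (t, i)))).mul
      (HasTauDeg.X (Sum.inr (finProdFinEquiv (finRotate (m + 2) t, j))))).mul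
      (HasTauDeg.X (Sum.inl (j, i)))
    exact h.mono (by omega) (by omega)
  have hj : ∀ (t i : Fin (m + 2)),
      HasTauDeg (∑ j : Fin (m + 2), (X (Sum.inr (finProdFinEquiv (t, i))) *
          X (Sum.inr (finProdFinEquiv (finRotate (m + 2) t, j))) * X (Sum.inl (j, i)) :
        MvPolynomial (HCVars m) ℤ)) (3 * (m + 2)) 3 := by
    intro t i
    refine (HasTauDeg.finset_sum _ fun j _ => hterm t i j).mono ?_ ?_
    · simp; omega
    · simp
  have hi : ∀ t ∈ (Finset.univ : Finset (Fin (m + 2))),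
      HasTauDeg (∑ i : Fin (m + 2), ∑ j : Fin (m + 2), (X (Sum.inr (finProdFinEquiv (t, i))) *
          X (Sum.inr (finProdFinEquiv (finRotate (m + 2) t, j))) * X (Sum.inl (j, i)) :
        MvPolynomial (HCVars m) ℤ)) (3 * (m + 2) * (m + 2) + (m + 2)) 3 := by
    intro t _
    refine (HasTauDeg.finset_sum _ fun i _ => hj t i).mono ?_ ?_
    · simp; ring_nf; omega
    · simp
  refine (HasTauDeg.finset_prod _ hi).mono ?_ ?_
  · simp
  · simp

/-- **The witness `G_{m+2}` is constant-free cheap**: size `≤ 9 (m+2)^4`, formal degree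
`≤ 3 (m+2)^4`. [cite: BurgisserClausenShokrollahi1997, Prop. (21.15)] -/
theorem hasTauDeg_hcVNPWitness (m : ℕ) :
    HasTauDeg (hcVNPWitness m ℤ) (9 * (m + 2) ^ 4) (3 * (m + 2) ^ 4) := by
  unfold hcVNPWitness
  have h := ((hasTauDeg_hcVNPAlpha m).mul (hasTauDeg_hcVNPBeta m)).mul
    ((HasTauDeg.X (σ := HCVars m)
      (Sum.inr (finProdFinEquiv ((0 : Fin (m + 2)), (0 : Fin (m + 2)))))).mul
      (hasTauDeg_hcVNPCover m))
  refine h.mono ?_ ?_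
  · ring_nf; omega
  · ring_nf; omega

/-- Uniform bounds for the whole family (`0` for `n ≤ 1`): size `≤ 9 n^4`, formal degree
`≤ 3 n^4 + 1`. [cite: BurgisserClausenShokrollahi1997, Prop. (21.15)] -/
theorem hasTauDeg_hcVNPFamily (n : ℕ) :
    HasTauDeg (hcVNPFamily ℤ n) (9 * n ^ 4) (3 * n ^ 4 + 1) := by
  match n with
  | 0 => exact HasTauDeg.zero.mono (Nat.zero_le _) (by norm_num)
  | 1 => exact HasTauDeg.zero.mono (Nat.zero_le _) (by norm_num)
  | m + 2 => exact (hasTauDeg_hcVNPWitness m).mono le_rfl (Nat.le_succ _)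

/-! ### `VP⁰` and `VNP⁰` membership -/

/-- **The witness family is in `VP⁰`** (`2n²` variables, constant-free circuits of size `≤ 9n⁴`
and formal degree `≤ 3n⁴ + 1`; Bürgisser 2009, Def. 2.7). [cite: Burgisser2006, Def. 2.7] -/
theorem isVP0Family_hcVNPFamily :
    IsVP0Family (σ := fun n => (Fin n × Fin n) ⊕ Fin (n * n)) (hcVNPFamily ℤ) := by
  have h := fun n => hasTauDeg_hcVNPFamily n
  choose P h1 h2 h3 h4 h5 using h
  refine ⟨?_, P, fun n => ⟨h1 n, h2 n, h3 n⟩, ?_, ?_⟩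
  · refine (IsPBounded.iff_exists_le_mul_succ_pow _).2 ⟨2, 2, fun n => ?_⟩
    simp only [Fintype.card_sum, Fintype.card_prod, Fintype.card_fin]
    nlinarith
  · refine (IsPBounded.iff_exists_le_mul_succ_pow _).2 ⟨9, 4, fun n => (h4 n).trans ?_⟩
    exact Nat.mul_le_mul_left _ (Nat.pow_le_pow_left (Nat.le_succ n) 4)
  · refine (IsPBounded.iff_exists_le_mul_succ_pow _).2 ⟨4, 4, fun n => (h5 n).trans ?_⟩
    have : n ^ 4 ≤ (n + 1) ^ 4 := Nat.pow_le_pow_left (Nat.le_succ n) 4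
    have : 1 ≤ (n + 1) ^ 4 := Nat.one_le_pow _ _ (Nat.succ_pos n)
    omega

/-- **`HC ∈ VNP⁰`**: the Hamiltonian cycle family `(HC_n)_n` (integer coefficients, variables
`Fin n × Fin n`) is in the constant-free class `VNP⁰`, with the position-matrix witness and a
Boolean sum of length `n²` (Tavenas 2014, §1.3, p. 18: "`Ham_n ∈ VNP0`"; BCS 1997,
Prop. (21.15)). [cite: Tavenas2014, §1.3 (p. 18)] -/
theorem isVNP0Family_hcPoly :
    IsVNP0Family (σ := fun n => Fin n × Fin n) fun n => hcPoly (Fin n) ℤ :=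
  ⟨fun n => n * n, hcVNPFamily ℤ, isVP0Family_hcVNPFamily,
    fun n => (boolSum_hcVNPFamily ℤ n).symm⟩

end Literature.Computability.AlgebraicComplexity
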